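import Summits.BirchSwinnertonDyer.BirchSwinnertonDyer.Theorems.KolyvaginDepthDoorDepthTableRowsSecondSign11
import HarnessLib

/-!
# Route `KolyvaginDepthDoor` — DEPTH-ZERO VANISHING ROWS ON THE SECOND SIGN, bit-free: the class of the
# basic Heegner point `y_K` dies in `H¹(K, E[p])` for rank-one curves with a rank-two Heegner
# twist, part 3 (crux `KolyvaginDepthSupply`, stmt-BirchSwinnertonDyer-21765)

Helper file (`--supports stmt-BirchSwinnertonDyer-21765 --as helper`); it closes nothing and BSD is
not proved by it.

Companion of the second-sign rows `SecondSign.C<label>.depthRow_<p>_neg<|D|>_<ℓ>_secondSign` (files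
`…DepthTableRowsSecondSign1–6`): there the bit `c_1(ℓ) ≠ 0` is the input. Here NO class is computed:
for each `(E, D, p)` of the second-sign table the kit's bit-free companion
`depthRowZeroTwist_vanishes_printKN_of_intModel_certificate` (g9's points-first vanishing
`kolyvaginClass_eq_zero_of_rank_of_datum_kodairaNeron` on the twist disjunct `ν + 2 ≤ rank E^{(d_K)}(ℚ)`,
`ν = 0`) turns the kernel certificate `2 ≤ rank_ℤ E^{(D)}(ℚ)` (two rational points on the twist model)
into: for ANY frame `(Dt, β, ι)` and ANY Kolyvagin–Heegner datum `d` of conductor `1`,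
`d.kolyvaginClass _ 1 = 0` — the class of `P(1) = Tr_{K[1]/K} y(1) = y_K` VANISHES in `H¹(K, E[p])`.
This is the mod-`p`, points-first shadow of what Gross–Zagier read off `L'(E/K, 1) = 0` (the Heegner
point `y_K` is torsion when `E^{(D)}` has analytic rank `2`; for `E = 37a1`, `D = −139` this is the
classical example of a vanishing Heegner point) and of Kolyvagin's theorem in contrapositive
(`rank E(K) = 1 + 2 ≥ 2` forces `y_K` torsion) — obtained here from the tree's PROVED minimal-depth
descent with the ONE named input (γ) = `GrossLMS1991.prop37_2_frobeniusCongruence`. JLS-falsifiable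
(`P(1) ∈ pE(K) + E(K)_tors`). CONDITIONAL on (γ); per-curve; BSD is not proved by it.

| curve | `p` | `d_K` | twist model | certified points on the twist |
|---|---|---|---|---|
| `163a1` = `[0,0,1,-2,1]` | `5` | `-11` | `[0,0,0,-3872,-106480]` | `(88, -484)`, `(11440/9, -1222100/27)` |

References: [Kolyvagin1991MathAnn] Thm. 2.3, Thm. 4; [GrossLMS1991] Prop. 3.7 (2), §4 (P_1 = y_K), §10;
[Kolyvagin1990] Thm. A; [SilvermanAEC2009] VII.6.1, VIII.6.7.
-/

set_option linter.dupNamespace false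

noncomputable section

open scoped Classical NumberField

namespace Summit.BirchSwinnertonDyer.BirchSwinnertonDyer.Theorems.KolyvaginDepthDoor

open Literature.NumberTheory.EllipticCurves Literature.NumberTheory.EllipticCurves.ModularForms
  WeierstrassCurve
open Summit.BirchSwinnertonDyer.BirchSwinnertonDyer.Rank2Observatory

namespace SecondSign

namespace C163a1

/-- **DEPTH-ZERO VANISHING ROW `163a1`, `(p, d_K) = (5, -11)` — NO bit.** For `E = 163a1` (rank one), ANY
imaginary quadratic `K` with `d_K = -11` (Heegner for `N_E`), any frame `(Dt, β, ι)` and ANY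
Kolyvagin–Heegner datum `d` of conductor `1`, granted (γ) = `GrossLMS1991.prop37_2_frobeniusCongruence`:
`d.kolyvaginClass _ 1 = 0` in `H¹(K, E[5])` — the class of `y_K` vanishes mod `5`, because the twist
`E^{(-11)}` has two independent rational points (`two_le_rank_twist_neg11`, kernel) and a non-zero
depth-`0` class would force `1 ≥ rank_ℤ E^{(d_K)}(ℚ)` (minimal-depth descent, proved in the tree);
side conditions from `…RowsSecondSign11`. CONDITIONAL on (γ); per-curve; BSD is not proved by it.
[cite: Kolyvagin1991MathAnn, Thm. 2.3 and Thm. 4] [cite: GrossLMS1991, Prop. 3.7 (2), §4 (P_1 = y_K), §10] -/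
theorem depthRowZero_5_neg11_vanishes_secondSign
    (h372 : GrossLMS1991.prop37_2_frobeniusCongruence)
    (K : Type) [Field K] [NumberField K] (hK : IsImaginaryQuadratic K)
    (hD : NumberField.discr K = -11) :
    haveI := isElliptic;
    haveI := isGloballyMinimal;
    haveI : NeZero (((⟨0, 0, 1, -2, 1⟩ : WeierstrassCurve ℤ).map (Int.castRingHom ℚ)).conductorNorm ℤ) := neZero_conductorNorm_of_isElliptic _;
    ∀ (Dt : ModularParametrizationData ((⟨0, 0, 1, -2, 1⟩ : WeierstrassCurve ℤ).map (Int.castRingHom ℚ)) (((⟨0, 0, 1, -2, 1⟩ : WeierstrassCurve ℤ).map (Int.castRingHom ℚ)).conductorNorm ℤ)) (β : ℤ) (ι : K →+* ℂ)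
      (d : KolyvaginHeegnerData Dt β ι 1),
    d.kolyvaginClass (p := 5) (by norm_num) 1 = 0 := by
  haveI := isElliptic
  haveI := isGloballyMinimal
  haveI : NeZero (((⟨0, 0, 1, -2, 1⟩ : WeierstrassCurve ℤ).map (Int.castRingHom ℚ)).conductorNorm ℤ) := neZero_conductorNorm_of_isElliptic _
  intro Dt β ι d
  haveI := Fact.mk (by norm_num : Nat.Prime 5)
  exact depthRowZeroTwist_vanishes_printKN_of_intModel_certificate intModel h372 not_hasCM 5
    (by norm_num) hasSurjectiveModNGaloisRep_pow_5 K hK hD (by norm_num) (by norm_num)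
    twistModel_neg11 two_le_rank_twist_neg11 heegner_neg11 (Δ₀ := -163) (by decide +kernel)
    (B := 11) (by decide +kernel) (by decide +kernel) (fun _ _ ↦ Or.inl (by norm_num)) Dt β ι d

end C163a1

end SecondSign

end Summit.BirchSwinnertonDyer.BirchSwinnertonDyer.Theorems.KolyvaginDepthDoor

end
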